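import Literature.Probability.Percolation.RaoufiBridges
import Literature.Probability.Percolation.BondPercolationSymmetry
import HarnessLib

/-!
# Hanging bridges and robust vertices (solo seat `solo-CriticalPhenomena-informed`, S17, part 1)

Deterministic graph theory of a bond configuration `ω : BondConfig V`, built on the bridge/side API
of `RaoufiBridges.lean` (`IsBridge`, `side`).

* `robust v` — the (increasing) event that the open cluster of `v` is infinite and stays infinite
  after closing any single edge: no open *bridge* separates `v` from infinity (`robust_mono`,
  `relabel_mem_robust_iff`).
* `hang v a b` — `s(a,b)` is a **hanging bridge** for `v`: a bridge with `v` on its finite `a`-side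
  and an infinite `b`-side; `exists_hang_of_finite` — if `C_ω(v)` is infinite but `C_{ω∖e}(v)` is
  finite then `e` is a hanging bridge for `v`.
* **The ladder** (`exists_hang_ssubset`, `exists_hang_le_ncard`): if `C_ω(v)` is infinite and no
  vertex of it is robust, then `v` hangs off bridges with arbitrarily large finite sides — the far
  endpoint `b` of a hanging bridge is not robust either, and a bridge separating `b` from infinity
  cannot sit inside the finite side of the first bridge (the infinite side would survive in `C(b)`),
  so it lies beyond it and its finite side strictly contains the old one together with `b`.

Used by `SoloInformedNoCriticalBackbone.lean` (one-edge surgery: in a world with `θ > 0` and finite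
finite-cluster susceptibility, robust vertices have positive density). [folklore]

Tree anchors: `IsBridge`, `side`, `IsBridge.mem_side_or`, `IsBridge.disjoint_sides`,
`IsBridge.notMem_side`, `mem_side_iff_of_ne`, `openCluster_eq_side_of_mem`,
`openCluster_subset_openCluster_sdiff`, `reachable_sdiff_or_exists_first` (`RaoufiBridges.lean`),
`relabel_mem_percolatesAt_iff`, `BondConfig.relabel` (`BondPercolationSymmetry.lean`).
-/

noncomputable section

namespace Summit.CriticalPhenomena.PercolationContinuityZ3.Theorems

open Literature.Probability.Percolation SimpleGraph

variable {V : Type*}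

/-! ### Hanging bridges and robust vertices (deterministic) -/

/-- The event that `s(a,b)` is a **hanging bridge** for `v`: an open bridge with `v` on its finite
`a`-side and with an infinite `b`-side. [folklore] -/
def hang (v a b : V) : Set (BondConfig V) :=
  {ω | IsBridge ω a b ∧ v ∈ side ω a b ∧ (side ω a b).Finite ∧ (side ω b a).Infinite}

/-- The event that `v` is **robust**: its open cluster is infinite and remains infinite after
closing any single edge (no bridge separates `v` from infinity). An increasing event. [folklore] -/
def robust (v : V) : Set (BondConfig V) :=
  {ω | (openCluster ω v).Infinite ∧ ∀ e : Sym2 V, (openCluster (ω \ {e}) v).Infinite}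

/-- Membership in `hang`, unfolded. [folklore] -/
theorem mem_hang_iff {ω : BondConfig V} {v a b : V} : ω ∈ hang v a b ↔
    IsBridge ω a b ∧ v ∈ side ω a b ∧ (side ω a b).Finite ∧ (side ω b a).Infinite := Iff.rfl

/-- Membership in `robust`, unfolded. [folklore] -/
theorem mem_robust_iff {ω : BondConfig V} {v : V} : ω ∈ robust v ↔
    (openCluster ω v).Infinite ∧ ∀ e : Sym2 V, (openCluster (ω \ {e}) v).Infinite := Iff.rfl

/-- Open paths survive enlarging the configuration. [folklore] -/
private theorem reachable_of_subset {ω ω' : BondConfig V} (h : ω ⊆ ω') {u v : V}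
    (huv : (openGraph ω).Reachable u v) : (openGraph ω').Reachable u v :=
  huv.mono (fromEdgeSet_mono h)

/-- **A bridge to infinity.** If `C_ω(v)` is infinite but becomes finite when the edge `e` is
closed, then `e = s(a,b)` is a hanging bridge for `v`. [folklore] -/
theorem exists_hang_of_finite {ω : BondConfig V} {v : V} (hinf : (openCluster ω v).Infinite)
    {e : Sym2 V} (hfin : (openCluster (ω \ {e}) v).Finite) :
    ∃ a b, s(a, b) = e ∧ ω ∈ hang v a b := by
  -- a vertex of `C_ω(v)` lost when `e` is closed, and an open walk to it: the walk uses `e`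
  obtain ⟨y, hyω, hye⟩ := (hinf.sdiff hfin).nonempty
  obtain ⟨p⟩ := (show (openGraph ω).Reachable v y from hyω)
  rcases reachable_sdiff_or_exists_first {e} p with hreach | ⟨a, b, habe, -, habω, hab, hva⟩
  · exact absurd hreach hye
  rw [Set.mem_singleton_iff] at habe
  subst habe
  refine ⟨a, b, rfl, ?_⟩
  -- `s(a,b)` is a bridge: otherwise `y` would still be joined to `v`
  have hbridge : IsBridge ω a b := by
    refine ⟨habω, hab, fun hr => hye ?_⟩
    rcases reachable_sdiff_or_exists_first {s(a, b)} p.reverse with hreach | ⟨a', b', he', -, -, -, hya'⟩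
    · exact hreach.symm
    · rw [Set.mem_singleton_iff] at he'
      have hva' : (openGraph (ω \ {s(a, b)})).Reachable v a' := by
        rcases Sym2.eq_iff.1 he' with ⟨rfl, rfl⟩ | ⟨rfl, rfl⟩
        · exact hva
        · exact hva.trans hr
      exact hva'.trans hya'.symm
  have hv : v ∈ side ω a b := hva.symm
  refine ⟨hbridge, hv, ?_, ?_⟩
  · rwa [← openCluster_eq_side_of_mem hv]
  · intro hfinb
    have hfina : (side ω a b).Finite := by rwa [← openCluster_eq_side_of_mem hv]
    refine hinf ((hfina.union hfinb).subset fun z hz => ?_)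
    have haz : (openGraph ω).Reachable a z :=
      (reachable_of_subset Set.sdiff_subset hva).symm.trans hz
    exact hbridge.mem_side_or haz

section Hang

variable {ω : BondConfig V} {v a b : V}

/-- The far endpoint of a hanging bridge is joined to `v`. [folklore] -/
theorem reachable_far_of_mem_hang (h : ω ∈ hang v a b) : (openGraph ω).Reachable v b := by
  have hav : (openGraph ω).Reachable a v := reachable_of_subset Set.sdiff_subset h.2.1
  have hab : (openGraph ω).Adj a b := by rw [openGraph_adj]; exact ⟨h.1.1, h.1.2.1⟩
  exact hav.symm.trans hab.reachable

/-- The far endpoint of a hanging bridge has an infinite cluster. [folklore] -/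
theorem infinite_far_of_mem_hang (h : ω ∈ hang v a b) : (openCluster ω b).Infinite :=
  h.2.2.2.mono (by rw [side_swap_eq]; exact openCluster_mono Set.sdiff_subset b)

/-- Closing a hanging bridge leaves `v` in its finite side. [folklore] -/
theorem openCluster_sdiff_eq_side_of_mem_hang (h : ω ∈ hang v a b) :
    openCluster (ω \ {s(a, b)}) v = side ω a b :=
  openCluster_eq_side_of_mem h.2.1

/-- **The ladder step.** If `s(a,b)` is a hanging bridge for `v` and the far endpoint `b` is itself
separated from infinity by closing some edge `e'`, then `v` hangs off a bridge whose finite side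
strictly contains the finite side of `s(a,b)` (indeed contains `b`). The point: a bridge separating
`b` from infinity cannot lie inside the finite side of `s(a,b)` (the infinite side of `s(a,b)`
would survive in `C(b)`), so it lies beyond `s(a,b)`, and then the whole finite side of `s(a,b)`,
together with `b`, is on its near side. [folklore] -/
theorem exists_hang_ssubset (h : ω ∈ hang v a b) {e' : Sym2 V}
    (hfin : (openCluster (ω \ {e'}) b).Finite) :
    ∃ a₂ b₂, ω ∈ hang v a₂ b₂ ∧ side ω a b ⊂ side ω a₂ b₂ := by
  obtain ⟨a₂, b₂, -, h₂⟩ := exists_hang_of_finite (infinite_far_of_mem_hang h) hfin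
  have hb₂ : b ∈ side ω a₂ b₂ := h₂.2.1
  -- the two bridges are distinct
  have hne : s(a, b) ≠ s(a₂, b₂) := by
    intro heq
    rcases Sym2.eq_iff.1 heq with ⟨rfl, rfl⟩ | ⟨rfl, rfl⟩
    · exact h.1.notMem_side hb₂
    · exact h₂.2.2.1.not_infinite h.2.2.2
  -- `a` is on the near side of the new bridge, like `b`
  have ha₂ : a ∈ side ω a₂ b₂ := (mem_side_iff_of_ne h.1.1 h.1.2.1 hne).2 hb₂
  have hreach : (openGraph ω).Reachable a a₂ :=
    (reachable_of_subset Set.sdiff_subset (show (openGraph _).Reachable a₂ a from ha₂)).symm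
  rcases h.1.mem_side_or hreach with hA | hA
  · -- the new bridge inside the finite side of the old one: impossible
    exfalso
    have hB : b₂ ∈ side ω a b := (mem_side_iff_of_ne h₂.1.1 h₂.1.2.1 hne.symm).1 hA
    have hsub : side ω b a ⊆ openCluster (ω \ {s(a₂, b₂)}) b := by
      rw [side_swap_eq]
      refine (openCluster_subset_openCluster_sdiff (T := {s(a₂, b₂)}) ?_).trans
        (openCluster_mono (Set.sdiff_subset_sdiff_left Set.sdiff_subset) b)
      intro e he _ y hy hyb
      rw [Set.mem_singleton_iff] at he
      subst he
      have hyb' : y ∈ side ω b a := by rwa [side_swap_eq]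
      rcases Sym2.mem_iff.1 hy with rfl | rfl
      · exact h.1.disjoint_sides hA hyb'
      · exact h.1.disjoint_sides hB hyb'
    rw [openCluster_eq_side_of_mem hb₂] at hsub
    exact h.2.2.2 (h₂.2.2.1.subset hsub)
  · -- the new bridge beyond the old one: the old finite side is inside the new one
    have hB : b₂ ∈ side ω b a :=
      (mem_side_iff_of_ne h₂.1.1 h₂.1.2.1 fun heq => hne (heq.trans Sym2.eq_swap).symm).1 hA
    have hsub : side ω a b ⊆ side ω a₂ b₂ := by
      rw [← openCluster_eq_side_of_mem ha₂]
      refine (openCluster_subset_openCluster_sdiff (T := {s(a₂, b₂)}) ?_).trans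
        (openCluster_mono (Set.sdiff_subset_sdiff_left Set.sdiff_subset) a)
      intro e he _ y hy hya
      rw [Set.mem_singleton_iff] at he
      subst he
      rcases Sym2.mem_iff.1 hy with rfl | rfl
      · exact h.1.disjoint_sides hya hA
      · exact h.1.disjoint_sides hya hB
    exact ⟨a₂, b₂, ⟨h₂.1, hsub h.2.1, h₂.2.2.1, h₂.2.2.2⟩, hsub,
      fun hsup => h.1.notMem_side (hsup hb₂)⟩

end Hang

/-- In one open cluster all vertices have the same cluster. [folklore] -/
private theorem openCluster_eq_of_reachable {ω : BondConfig V} {v u : V}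
    (h : (openGraph ω).Reachable v u) : openCluster ω u = openCluster ω v := by
  ext z
  exact ⟨fun hz => h.trans hz, fun hz => h.symm.trans hz⟩

/-- **The hanging-bridge ladder.** If `C_ω(v)` is infinite and no vertex of it is robust, then `v`
hangs off bridges with arbitrarily large finite sides. [folklore] -/
theorem exists_hang_le_ncard {ω : BondConfig V} {v : V} (hinf : (openCluster ω v).Infinite)
    (hno : ∀ u, (openGraph ω).Reachable v u → ω ∉ robust u) (m : ℕ) :
    ∃ a b, ω ∈ hang v a b ∧ m ≤ (side ω a b).ncard := by
  have hno' : ∀ u, (openGraph ω).Reachable v u → ∃ e, (openCluster (ω \ {e}) u).Finite := by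
    intro u hu
    have h := hno u hu
    simp only [robust, Set.mem_setOf_eq, not_and, not_forall, Set.not_infinite] at h
    exact h (by rw [openCluster_eq_of_reachable hu]; exact hinf)
  induction m with
  | zero =>
    obtain ⟨e, he⟩ := hno' v (Reachable.refl v)
    obtain ⟨a, b, -, h⟩ := exists_hang_of_finite hinf he
    exact ⟨a, b, h, Nat.zero_le _⟩
  | succ m ih =>
    obtain ⟨a, b, h, hm⟩ := ih
    obtain ⟨e', he'⟩ := hno' b (reachable_far_of_mem_hang h)
    obtain ⟨a₂, b₂, h₂, hss⟩ := exists_hang_ssubset h he'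
    exact ⟨a₂, b₂, h₂, by have := Set.ncard_lt_ncard hss h₂.2.2.1; omega⟩

/-- Robustness is an increasing event. [folklore] -/
theorem robust_mono {ω ω' : BondConfig V} (h : ω ⊆ ω') (v : V) (hω : ω ∈ robust v) :
    ω' ∈ robust v :=
  ⟨hω.1.mono (openCluster_mono h v),
    fun e => (hω.2 e).mono (openCluster_mono (Set.sdiff_subset_sdiff_left h) v)⟩

/-- Robustness is transported by relabelling along a bijection of the vertices. [folklore] -/
theorem relabel_mem_robust_iff {W : Type*} (φ : V ≃ W) (ω : BondConfig V) (u : V) :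
    BondConfig.relabel (sym2Equiv φ) ω ∈ robust (φ u) ↔ ω ∈ robust u := by
  have hdiff : ∀ e : Sym2 V, BondConfig.relabel (sym2Equiv φ) ω \ {sym2Equiv φ e} =
      BondConfig.relabel (sym2Equiv φ) (ω \ {e}) := by
    intro e
    rw [BondConfig.relabel_apply, BondConfig.relabel_apply, Set.image_sdiff (sym2Equiv φ).injective,
      Set.image_singleton]
  have h1 : ∀ η : BondConfig V, (openCluster (BondConfig.relabel (sym2Equiv φ) η) (φ u)).Infinite ↔
      (openCluster η u).Infinite := fun η => relabel_mem_percolatesAt_iff φ η u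
  simp only [robust, Set.mem_setOf_eq, h1]
  refine and_congr Iff.rfl ⟨fun h e => ?_, fun h e' => ?_⟩
  · have := h (sym2Equiv φ e)
    rwa [hdiff, h1] at this
  · obtain ⟨e, rfl⟩ := (sym2Equiv φ).surjective e'
    rw [hdiff, h1]
    exact h e

end Summit.CriticalPhenomena.PercolationContinuityZ3.Theorems
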